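import Literature.Barriers.CriticalPhenomena.LongRangeTrivialityOnZ3TwoPoint

/-!
# Discharge of `panis_boxSusceptibility_le_blockVariance`: `χ_L(β) ≤ L^{-d} Σ_L(β)`

Sibling of `Literature/Barriers/CriticalPhenomena/LongRangeTrivialityOnZ3TwoPoint.lean` (barrier catalogue
D-0021, sub-problem `Ising3DConformalLimit`), which vendors as the named fact
`panis_boxSusceptibility_le_blockVariance` the inequality "`χ_L(β) ≤ C₂ L^{-d} Σ_L(β)`" that the proof
of Theorem 5.5 of Panis 2023 (arXiv:2309.05797, p. 22) uses twice and asserts without proof, for the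
couplings `J_{x,y} = C₀|x-y|₁^{-d-α}` and `0 < β ≤ β_c`. Here `χ_L(β) = ∑_{x∈Λ_L} ⟨σ₀σ_x⟩_β`
(`LongRangeIsing.boxSusceptibility`) and `Σ_L(β) = ⟨(∑_{x∈Λ_L}σ_x)²⟩_β = ∑_{x,y∈Λ_L} ⟨σ_xσ_y⟩_β`
(`LongRangeIsing.blockVariance`, `blockVariance_eq_sum`).

This file PROVES it (`panis_boxSusceptibility_le_blockVariance_holds`, with `C₂ = 1`) through the
general elementary statement `LongRangeIsing.pow_mul_boxSusceptibility_le_blockVariance`: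
for every translation-invariant `J ≥ 0` and `β ≥ 0`, `(L+1)^d χ_L(β) ≤ Σ_L(β)`. Argument (ours; the
source prints none): in the double sum `Σ_L` keep, for each `x ∈ Λ_L`, the terms `y = x + z` with
`z ∈ Λ_L` — the dropped terms are `≥ 0` by Griffiths' first inequality (`pairCorrelation_nonneg`);
by translation invariance (`pairCorrelation_zero_sub`) `⟨σ_xσ_{x+z}⟩ = ⟨σ₀σ_z⟩`, and after swapping the
sums the coefficient of `⟨σ₀σ_z⟩` is `#{x ∈ Λ_L : x + z ∈ Λ_L} ≥ (L+1)^d` (the orthant box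
`∏ᵢ (zᵢ ≥ 0 ? [-L,0] : [0,L])`, `pow_succ_le_card_filter_add_mem_box`). Hence
`χ_L ≤ (L+1)^{-d} Σ_L ≤ L^{-d} Σ_L` for `L ≥ 1` (`boxSusceptibility_le_inv_pow_mul_blockVariance`); the
restriction `β ≤ β_c` of the named fact is not used.

## References

* R. Panis, arXiv:2309.05797 (2023) = Ann. Probab. 54 (2026): proof of Theorem 5.5, bound on (1)
  ("using that `χ_L(β) ≤ C₂L^{-d}Σ_L(β)`") and bound on (2) ("and again `χ_L(β) ≤ C₂L^{-d}Σ_L(β)` in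
  the third line"), p. 22; §3 (`χ_L`), §1.2.1 (`Σ_L`) [Panis2023Triviality] (held; read pp. 21–22).

## Mathlib / tree anchors

`Fintype.piFinset`, `Fintype.card_piFinset`, `Int.card_Icc`, `Finset.sum_filter`, `Finset.sum_comm`,
`Finset.sum_image`, `Finset.sum_le_sum_of_subset_of_nonneg`, `Finset.card_le_card`; tree: `box`, `mem_box`,
`blockVariance_eq_sum`, `pairCorrelation_eq`, `pairCorrelation_nonneg`, `pairCorrelation_zero_sub`,
`boxSusceptibility_nonneg`, `algebraicCoupling_nonneg`, `algebraicCoupling_add`.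
-/

noncomputable section

namespace Literature.Barriers.CriticalPhenomena

open Literature.Probability.LatticeModels Literature.Probability.Percolation Finset
open scoped symmDiff

/-! ### `(L+1)^d χ_L(β) ≤ Σ_L(β)` and the discharge -/

namespace LongRangeIsing

section BoxSusceptibilityLeBlockVariance

variable {d : ℕ} (J : Site d → Site d → ℝ) (β : ℝ)

/-- For `z ∈ Λ_L`, at least `(L+1)^d` sites `x ∈ Λ_L` have `x + z ∈ Λ_L`: the orthant box
`∏ᵢ (zᵢ ≥ 0 ? [-L,0] : [0,L])` consists of such sites. [folklore] -/
theorem pow_succ_le_card_filter_add_mem_box {L : ℕ} {z : Site d} (hz : z ∈ box d L) :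
    ((L : ℝ) + 1) ^ d ≤ (#((box d L).filter fun x => x + z ∈ box d L) : ℝ) := by
  classical
  rw [mem_box] at hz
  set T : Finset (Site d) :=
    Fintype.piFinset fun i => if 0 ≤ z i then Finset.Icc (-(L : ℤ)) 0 else Finset.Icc (0 : ℤ) L with hT
  have hTcard : #T = (L + 1) ^ d := by
    have hi : ∀ i : Fin d, #(if 0 ≤ z i then Finset.Icc (-(L : ℤ)) 0 else Finset.Icc (0 : ℤ) L) = L + 1 := by
      intro i
      split_ifs
      · rw [Int.card_Icc]; omega
      · rw [Int.card_Icc]; omega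
    rw [hT, Fintype.card_piFinset, Finset.prod_congr rfl fun i _ => hi i, Finset.prod_const,
      Finset.card_univ, Fintype.card_fin]
  have hTsub : T ⊆ (box d L).filter fun x => x + z ∈ box d L := by
    intro x hx
    rw [hT, Fintype.mem_piFinset] at hx
    rw [Finset.mem_filter, mem_box, mem_box]
    refine ⟨fun i => ?_, fun i => ?_⟩
    · have h := hx i
      split_ifs at h
      · rw [Finset.mem_Icc] at h; omega
      · rw [Finset.mem_Icc] at h; omega
    · have h := hx i
      obtain ⟨hz1, hz2⟩ := hz i
      simp only [Pi.add_apply]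
      split_ifs at h with h0
      · rw [Finset.mem_Icc] at h; omega
      · rw [Finset.mem_Icc] at h; omega
  calc ((L : ℝ) + 1) ^ d = ((#T : ℕ) : ℝ) := by rw [hTcard]; push_cast; ring
    _ ≤ _ := by exact_mod_cast Finset.card_le_card hTsub

/-- **`(L+1)^d χ_L(β) ≤ Σ_L(β)`** for every translation-invariant ferromagnetic pair interaction
`J ≥ 0` and `β ≥ 0`: in `Σ_L(β) = ∑_{x,y ∈ Λ_L} ⟨σ_xσ_y⟩_β` keep, for each `x`, the terms `y = x + z`
with `z ∈ Λ_L` (the others are `≥ 0` by Griffiths' first inequality), use `⟨σ_xσ_{x+z}⟩ = ⟨σ₀σ_z⟩`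
and swap the sums: `Σ_L ≥ ∑_{z ∈ Λ_L} #{x ∈ Λ_L : x + z ∈ Λ_L} ⟨σ₀σ_z⟩ ≥ (L+1)^d χ_L`. This is the
elementary content of "`χ_L(β) ≤ C₂ L^{-d} Σ_L(β)`" (Panis 2023, proof of Theorem 5.5, p. 22, asserted
there without proof). [cite: Panis2023Triviality, proof of Theorem 5.5, bound on (1) ("χ_L(β) ≤ C₂L^{-d}Σ_L(β)"), p. 22] -/
theorem pow_mul_boxSusceptibility_le_blockVariance (hβ : 0 ≤ β) (hJ : ∀ x y, 0 ≤ J x y)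
    (hJt : ∀ a x y, J (x + a) (y + a) = J x y) (L : ℕ) :
    ((L : ℝ) + 1) ^ d * boxSusceptibility J β L ≤ blockVariance J β L := by
  classical
  -- `Σ_L` as a double sum of two-point functions
  have hS : blockVariance J β L = ∑ x ∈ box d L, ∑ y ∈ box d L, pairCorrelation J β x y := by
    rw [blockVariance_eq_sum J β hβ hJ L]
    simp_rw [pairCorrelation_eq]
  -- for each `x`, keep the terms `y = x + z`, `z ∈ Λ_L`
  have h1 : ∀ x ∈ box d L,
      ∑ z ∈ (box d L).filter (fun z => x + z ∈ box d L), pairCorrelation J β 0 z ≤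
        ∑ y ∈ box d L, pairCorrelation J β x y := by
    intro x _
    calc ∑ z ∈ (box d L).filter (fun z => x + z ∈ box d L), pairCorrelation J β 0 z
        = ∑ z ∈ (box d L).filter (fun z => x + z ∈ box d L), pairCorrelation J β x (x + z) := by
          refine Finset.sum_congr rfl fun z _ => ?_
          rw [← pairCorrelation_zero_sub J β hβ hJ hJt x (x + z), add_sub_cancel_left]
      _ = ∑ y ∈ ((box d L).filter (fun z => x + z ∈ box d L)).image (x + ·), pairCorrelation J β x y := by
          rw [Finset.sum_image fun z _ z' _ h => add_left_cancel h]
      _ ≤ ∑ y ∈ box d L, pairCorrelation J β x y := by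
          refine Finset.sum_le_sum_of_subset_of_nonneg (fun y hy => ?_)
            fun y _ _ => pairCorrelation_nonneg J β hβ hJ x y
          obtain ⟨z, hz, rfl⟩ := Finset.mem_image.1 hy
          exact (Finset.mem_filter.1 hz).2
  -- swap the sums: the coefficient of `⟨σ₀σ_z⟩` is `#{x ∈ Λ_L : x + z ∈ Λ_L}`
  have h2 : ∑ x ∈ box d L, ∑ z ∈ (box d L).filter (fun z => x + z ∈ box d L), pairCorrelation J β 0 z =
      ∑ z ∈ box d L, (#((box d L).filter fun x => x + z ∈ box d L) : ℝ) * pairCorrelation J β 0 z := by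
    simp_rw [Finset.sum_filter]
    rw [Finset.sum_comm]
    refine Finset.sum_congr rfl fun z _ => ?_
    rw [← Finset.sum_filter, Finset.sum_const, nsmul_eq_mul]
  calc ((L : ℝ) + 1) ^ d * boxSusceptibility J β L
      = ∑ z ∈ box d L, ((L : ℝ) + 1) ^ d * pairCorrelation J β 0 z := by
        rw [boxSusceptibility, Finset.mul_sum]
    _ ≤ ∑ z ∈ box d L, (#((box d L).filter fun x => x + z ∈ box d L) : ℝ) * pairCorrelation J β 0 z :=
        Finset.sum_le_sum fun z hz => mul_le_mul_of_nonneg_right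
          (pow_succ_le_card_filter_add_mem_box hz) (pairCorrelation_nonneg J β hβ hJ 0 z)
    _ = ∑ x ∈ box d L, ∑ z ∈ (box d L).filter (fun z => x + z ∈ box d L), pairCorrelation J β 0 z :=
        h2.symm
    _ ≤ ∑ x ∈ box d L, ∑ y ∈ box d L, pairCorrelation J β x y := Finset.sum_le_sum h1
    _ = blockVariance J β L := hS.symm

/-- **`χ_L(β) ≤ L^{-d} Σ_L(β)`** for `L ≥ 1`, translation-invariant `J ≥ 0`, `β ≥ 0` (from
`(L+1)^d χ_L ≤ Σ_L` and `L^d ≤ (L+1)^d`, `χ_L ≥ 0`).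
[cite: Panis2023Triviality, proof of Theorem 5.5, bound on (1) ("χ_L(β) ≤ C₂L^{-d}Σ_L(β)"), p. 22] -/
theorem boxSusceptibility_le_inv_pow_mul_blockVariance (hβ : 0 ≤ β) (hJ : ∀ x y, 0 ≤ J x y)
    (hJt : ∀ a x y, J (x + a) (y + a) = J x y) {L : ℕ} (hL : 1 ≤ L) :
    boxSusceptibility J β L ≤ ((L : ℝ) ^ d)⁻¹ * blockVariance J β L := by
  have h := pow_mul_boxSusceptibility_le_blockVariance J β hβ hJ hJt L
  have hL0 : 0 < (L : ℝ) ^ d := by positivity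
  have hχ0 : 0 ≤ boxSusceptibility J β L := boxSusceptibility_nonneg J β hβ hJ L
  rw [← div_eq_inv_mul, le_div_iff₀ hL0]
  calc boxSusceptibility J β L * (L : ℝ) ^ d ≤ boxSusceptibility J β L * ((L : ℝ) + 1) ^ d :=
        mul_le_mul_of_nonneg_left (pow_le_pow_left₀ (by positivity) (by linarith) d) hχ0
    _ = ((L : ℝ) + 1) ^ d * boxSusceptibility J β L := mul_comm _ _
    _ ≤ blockVariance J β L := h

end BoxSusceptibilityLeBlockVariance

end LongRangeIsing

open LongRangeIsing

/-- **Discharge of the named fact `panis_boxSusceptibility_le_blockVariance`** (Panis 2023, proof of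
Theorem 5.5, p. 22: "using that `χ_L(β) ≤ C₂L^{-d}Σ_L(β)`"), with `C₂ = 1`, for the couplings
`J_{x,y} = C₀|x-y|₁^{-d-α}` (nonnegative and translation invariant) and every `β > 0` — the
restriction `β ≤ β_c` is not needed. From `LongRangeIsing.boxSusceptibility_le_inv_pow_mul_blockVariance`.
[cite: Panis2023Triviality, proof of Theorem 5.5, bound on (1) ("χ_L(β) ≤ C₂L^{-d}Σ_L(β)"), p. 22] -/
theorem panis_boxSusceptibility_le_blockVariance_holds : panis_boxSusceptibility_le_blockVariance := by
  intro d _ C₀ α hC₀ _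
  refine ⟨1, one_pos, fun β hβ _ L hL => ?_⟩
  rw [one_mul]
  exact boxSusceptibility_le_inv_pow_mul_blockVariance (algebraicCoupling d C₀ α) β hβ.le
    (algebraicCoupling_nonneg hC₀.le α) (algebraicCoupling_add C₀ α) hL

end Literature.Barriers.CriticalPhenomena

end
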